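import Mathlib
import Summits.Ventures.HodgeRepro2.T5AdicCompletionHenselian
import Summits.Ventures.HodgeRepro2.T5AdicCompletionRamified
import Summits.Ventures.HodgeRepro2.T5AdicCompletionConjugation
import Summits.Ventures.HodgeRepro2.T5AdicCompletionGaloisInvariance
import Summits.Ventures.HodgeRepro2.T5AdicCompletionIntegral
import Summits.Ventures.HodgeRepro2.T5UnramifiedNormApprox

/-!
# Unit norms at a tamely ramified place: `N(O_{E_v}^×) = {u ∈ O_{F_v}^× : ū is a square}`, of index 2

THE RAMIFIED HALF (residue characteristic `≠ 2`) of the local norm index theorem for units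
(Serre, *Local Fields*, Ch. V §3; route/T5-route-2.md (A8a) / (A11): «η_v(u) = the Legendre symbol
of ū at a tamely ramified place»): on Mathlib's completions `Kv ⊆ Lw` with `[Lw : Kv] = 2`,
`ϖ` irreducible in `O_Kv` but NOT in `O_Lw` (ramified, `T5AdicCompletionRamified`), `σ ≠ 1` and
`2` a unit of `O_Kv`:

* every norm `x · σ x` of an integer `x` is a square modulo `𝔪_Kv`
  (`exists_sq_add_mem_of_normConj`: residue degree one, Galois invariance of `v`);
* every unit whose residue is a square is a norm (`exists_normConj_eq_of_isSquare_residue`: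
  Hensel's lemma `T5AdicCompletionHenselian` makes it a square `a²`, and `a² = N a`);
* hence the unit norm group is `residueSquares` (`exists_normConj_eq_iff_isSquare_residue`), a
  subgroup of index 2 in `O_Kv^×` (`index_residueSquares_eq_two`, via Mathlib's `quadraticChar` of
  the residue field and a non-square `FiniteField.exists_nonsquare`).

Declaration per README §8(d): «uses an L-value-free non-vanishing device: NO».
-/

namespace Summit.Ventures.HodgeRepro2.T5TameRamifiedUnitNorms

open IsDedekindDomain HeightOneSpectrum IsLocalRing T5UnramifiedNormApprox

variable {K : Type*} [Field K] [NumberField K] (v : HeightOneSpectrum (NumberField.RingOfIntegers K))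

section ResidueSquares

/-- The units of `O_Kv` whose residue is a square, as a subgroup. -/
def residueSquares : Subgroup (adicCompletionIntegers K v)ˣ where
  carrier := {u | IsSquare (residue (adicCompletionIntegers K v) (u : adicCompletionIntegers K v))}
  mul_mem' := by
    intro a b ha hb
    simp only [Set.mem_setOf_eq, Units.val_mul, map_mul] at ha hb ⊢
    exact ha.mul hb
  one_mem' := by simp
  inv_mem' := by
    intro u hu
    simp only [Set.mem_setOf_eq] at hu ⊢
    have h : residue (adicCompletionIntegers K v) ((u⁻¹ : (adicCompletionIntegers K v)ˣ) : adicCompletionIntegers K v) =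
        (residue (adicCompletionIntegers K v) (u : adicCompletionIntegers K v))⁻¹ := by
      apply eq_inv_of_mul_eq_one_left
      rw [← map_mul, Units.inv_mul, map_one]
    rw [h]
    exact hu.inv

/-- Membership in `residueSquares`. -/
theorem mem_residueSquares_iff (u : (adicCompletionIntegers K v)ˣ) :
    u ∈ residueSquares v ↔ IsSquare (residue (adicCompletionIntegers K v) (u : adicCompletionIntegers K v)) :=
  Iff.rfl

/-- The residue field has characteristic `≠ 2` when `2` is a unit of `O_Kv`. -/
theorem ringChar_residueField_ne_two (h2u : IsUnit (2 : adicCompletionIntegers K v)) :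
    ringChar (ResidueField (adicCompletionIntegers K v)) ≠ 2 := by
  intro h
  have h0 : ((2 : ℕ) : ResidueField (adicCompletionIntegers K v)) = 0 := by
    rw [ringChar.spec, h]
  have : residue (adicCompletionIntegers K v) (2 : adicCompletionIntegers K v) ≠ 0 :=
    (residue_ne_zero_iff_isUnit _).mpr h2u
  apply this
  rw [map_ofNat]
  exact_mod_cast h0

/-- A non-square unit of `O_Kv` exists when `2` is a unit. -/
theorem exists_units_not_isSquare_residue (h2u : IsUnit (2 : adicCompletionIntegers K v)) :
    ∃ ε : (adicCompletionIntegers K v)ˣ,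
      ¬ IsSquare (residue (adicCompletionIntegers K v) (ε : adicCompletionIntegers K v)) := by
  obtain ⟨e, he⟩ := FiniteField.exists_nonsquare (ringChar_residueField_ne_two v h2u)
  obtain ⟨ε, rfl⟩ := residue_surjective e
  have hε : IsUnit ε := by
    rw [← residue_ne_zero_iff_isUnit]
    rintro h0
    apply he
    rw [h0]
    exact ⟨0, by simp⟩
  exact ⟨hε.unit, by simpa using he⟩

/-- In a finite field, multiplying a non-zero element by a non-square flips squareness (the
quadratic character is multiplicative with values `±1`). -/
theorem isSquare_mul_iff_not_isSquare {F : Type*} [Field F] [Fintype F] [DecidableEq F] {b e : F}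
    (hb : b ≠ 0) (he0 : e ≠ 0) (he : ¬ IsSquare e) : IsSquare (b * e) ↔ ¬ IsSquare b := by
  have heχ : quadraticChar F e = -1 := (quadraticChar_neg_one_iff_not_isSquare).mpr he
  rw [← quadraticChar_one_iff_isSquare (mul_ne_zero hb he0), ← quadraticChar_one_iff_isSquare hb,
    map_mul, heχ, mul_neg, mul_one]
  rcases quadraticChar_dichotomy hb with h | h
  · rw [h]; norm_num
  · rw [h]; norm_num

/-- `[O_Kv^× : residueSquares] = 2` when `2` is a unit (the quadratic character of the residue
field). -/
theorem index_residueSquares_eq_two (h2u : IsUnit (2 : adicCompletionIntegers K v)) :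
    (residueSquares v).index = 2 := by
  classical
  haveI : Fintype (ResidueField (adicCompletionIntegers K v)) := Fintype.ofFinite _
  obtain ⟨ε, hε⟩ := exists_units_not_isSquare_residue v h2u
  rw [Subgroup.index_eq_two_iff]
  refine ⟨ε, fun b => ?_⟩
  simp only [mem_residueSquares_iff, Units.val_mul, map_mul]
  have hb0 : residue (adicCompletionIntegers K v) (b : adicCompletionIntegers K v) ≠ 0 :=
    (residue_ne_zero_iff_isUnit _).mpr b.isUnit
  have hε0 : residue (adicCompletionIntegers K v) (ε : adicCompletionIntegers K v) ≠ 0 :=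
    (residue_ne_zero_iff_isUnit _).mpr ε.isUnit
  rw [isSquare_mul_iff_not_isSquare hb0 hε0 hε]
  by_cases h : IsSquare (residue (adicCompletionIntegers K v) (b : adicCompletionIntegers K v))
  · exact Or.inr ⟨h, not_not.mpr h⟩
  · exact Or.inl ⟨h, h⟩

end ResidueSquares

variable {L : Type*} [Field L] [NumberField L] [Algebra K L]
  (w : HeightOneSpectrum (NumberField.RingOfIntegers L)) [w.asIdeal.LiesOver v.asIdeal]
  (σ : Gal(adicCompletion L w/adicCompletion K v))
  (h2 : Module.finrank (adicCompletion K v) (adicCompletion L w) = 2)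
  {ϖ : adicCompletionIntegers K v} (hϖ : Irreducible ϖ)
  {π : adicCompletionIntegers L w} (hπ : Irreducible π)
  (hram : ¬ Irreducible (algebraMap (adicCompletionIntegers K v) (adicCompletionIntegers L w) ϖ))
  (hσ : σ ≠ 1)

/-- `algebraMap O_Kv O_Lw` is injective. -/
theorem algebraMap_injective :
    Function.Injective (algebraMap (adicCompletionIntegers K v) (adicCompletionIntegers L w)) := by
  intro a b h
  have : ((algebraMap (adicCompletionIntegers K v) (adicCompletionIntegers L w) a : adicCompletionIntegers L w) :
      adicCompletion L w) = ((algebraMap (adicCompletionIntegers K v) (adicCompletionIntegers L w) b :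
        adicCompletionIntegers L w) : adicCompletion L w) := by rw [h]
  exact Subtype.coe_injective ((algebraMap (adicCompletion K v) (adicCompletion L w)).injective this)

include h2 hσ in
/-- A `σ`-fixed element of `𝔪_Lw` comes from `𝔪_Kv`. -/
theorem exists_mem_maximalIdeal_of_fixed {y : adicCompletionIntegers L w}
    (hy : y ∈ maximalIdeal (adicCompletionIntegers L w))
    (hfix : T5AdicCompletionConjugation.restrictIntegers v w σ y = y) :
    ∃ r ∈ maximalIdeal (adicCompletionIntegers K v),
      y = algebraMap (adicCompletionIntegers K v) (adicCompletionIntegers L w) r := by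
  obtain ⟨r, rfl⟩ := T5AdicCompletionConjugation.exists_algebraMap_eq_of_restrictIntegers_eq v w h2 σ hσ hfix
  refine ⟨r, ?_, rfl⟩
  rw [T5AdicCompletionResidueField.mem_maximalIdeal_iff] at hy ⊢
  obtain ⟨e, he, hval⟩ := T5AdicCompletionIntegral.exists_val_algebraMap_eq_pow v w
  have hcoe : ((algebraMap (adicCompletionIntegers K v) (adicCompletionIntegers L w) r : adicCompletionIntegers L w) :
      adicCompletion L w) = algebraMap (adicCompletion K v) (adicCompletion L w) (r : adicCompletion K v) := rfl
  rw [hcoe, hval] at hy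
  have hle : Valued.v (r : adicCompletion K v) ≤ 1 := (mem_adicCompletionIntegers _ _ _).mp r.2
  rcases hle.lt_or_eq with h | h
  · exact h
  · rw [h, one_pow] at hy
    exact absurd hy (lt_irrefl _)

include h2 hϖ hπ hram hσ in
/-- EVERY NORM IS A SQUARE MODULO `𝔪_Kv`: `x · σ x = a² + r` with `a ∈ O_Kv`, `r ∈ 𝔪_Kv`
(residue degree one: `x ≡ a (mod π)`, and `σ` preserves `𝔪_Lw`). -/
theorem exists_sq_add_mem_of_normConj (x : adicCompletionIntegers L w) :
    ∃ a : adicCompletionIntegers K v, ∃ r ∈ maximalIdeal (adicCompletionIntegers K v),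
      normConj (T5AdicCompletionConjugation.restrictIntegers v w σ) x =
        algebraMap (adicCompletionIntegers K v) (adicCompletionIntegers L w) (a ^ 2 + r) := by
  obtain ⟨a, t, ht⟩ := T5AdicCompletionRamified.exists_dvd_sub_algebraMap_of_not_irreducible v w h2 hϖ hπ hram x
  set τ := T5AdicCompletionConjugation.restrictIntegers v w σ with hτ
  set A := algebraMap (adicCompletionIntegers K v) (adicCompletionIntegers L w) a with hA
  have hx : x = A + π * t := by rw [← ht]; ring
  have hτA : τ A = A := T5AdicCompletionConjugation.restrictIntegers_algebraMap v w σ a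
  -- the norm minus `a²` lies in `𝔪_Lw` and is `σ`-fixed
  have hπm : π ∈ maximalIdeal (adicCompletionIntegers L w) := by
    rw [hπ.maximalIdeal_eq]; exact Ideal.mem_span_singleton_self _
  have hτπt : τ (π * t) ∈ maximalIdeal (adicCompletionIntegers L w) := by
    rw [T5AdicCompletionResidueField.mem_maximalIdeal_iff, T5AdicCompletionConjugation.coe_restrictIntegers,
      T5AdicCompletionGaloisInvariance.val_algEquiv_apply,
      ← T5AdicCompletionResidueField.mem_maximalIdeal_iff]
    exact Ideal.mul_mem_right _ _ hπm
  have hy : normConj τ x - A ^ 2 ∈ maximalIdeal (adicCompletionIntegers L w) := by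
    have : normConj τ x - A ^ 2 = A * τ (π * t) + (π * t) * A + (π * t) * τ (π * t) := by
      rw [normConj_apply, hx, map_add, hτA]; ring
    rw [this]
    refine Ideal.add_mem _ (Ideal.add_mem _ ?_ ?_) ?_
    · exact Ideal.mul_mem_left _ _ hτπt
    · exact Ideal.mul_mem_right _ _ (Ideal.mul_mem_right _ _ hπm)
    · exact Ideal.mul_mem_right _ _ (Ideal.mul_mem_right _ _ hπm)
  have hfix : τ (normConj τ x - A ^ 2) = normConj τ x - A ^ 2 := by
    rw [map_sub, map_pow, hτA, conj_normConj τ (T5AdicCompletionConjugation.restrictIntegers_restrictIntegers v w h2 σ hσ)]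
  obtain ⟨r, hr, hyr⟩ := exists_mem_maximalIdeal_of_fixed v w σ h2 hσ hy hfix
  refine ⟨a, r, hr, ?_⟩
  rw [map_add, map_pow, ← hA, ← hyr]
  ring

/-- EVERY UNIT WITH SQUARE RESIDUE IS A NORM (Hensel: it is a square `a²`, and `a² = a · σ a`),
when `2` is a unit of `O_Kv`. -/
theorem exists_normConj_eq_of_isSquare_residue (h2u : IsUnit (2 : adicCompletionIntegers K v))
    (u : (adicCompletionIntegers K v)ˣ)
    (hu : IsSquare (residue (adicCompletionIntegers K v) (u : adicCompletionIntegers K v))) :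
    ∃ x : adicCompletionIntegers L w, normConj (T5AdicCompletionConjugation.restrictIntegers v w σ) x =
      algebraMap (adicCompletionIntegers K v) (adicCompletionIntegers L w) (u : adicCompletionIntegers K v) := by
  obtain ⟨e, he⟩ := hu
  obtain ⟨a₀, rfl⟩ := residue_surjective e
  have h1 : a₀ ^ 2 - (u : adicCompletionIntegers K v) ∈ maximalIdeal (adicCompletionIntegers K v) := by
    rw [← residue_eq_zero_iff, map_sub, map_pow, he, sq, sub_self]
  have ha₀ : IsUnit a₀ := by
    rw [← residue_ne_zero_iff_isUnit]
    intro h0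
    have : residue (adicCompletionIntegers K v) (u : adicCompletionIntegers K v) = 0 := by
      rw [he, h0, mul_zero]
    exact (residue_ne_zero_iff_isUnit _).mpr u.isUnit this
  obtain ⟨a, ha, -⟩ := T5AdicCompletionHenselian.exists_sq_eq_of_sq_sub_mem_maximalIdeal v _ a₀ h1 (h2u.mul ha₀)
  refine ⟨algebraMap (adicCompletionIntegers K v) (adicCompletionIntegers L w) a, ?_⟩
  rw [normConj_apply, T5AdicCompletionConjugation.restrictIntegers_algebraMap, ← map_mul, ← sq, ha]

include h2 hϖ hπ hram hσ in
/-- THE UNIT NORM GROUP AT A TAMELY RAMIFIED PLACE: a unit of `O_Kv` is a norm from `O_Lw` iff its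
residue is a square. -/
theorem exists_normConj_eq_iff_isSquare_residue (h2u : IsUnit (2 : adicCompletionIntegers K v))
    (u : (adicCompletionIntegers K v)ˣ) :
    (∃ x : adicCompletionIntegers L w, normConj (T5AdicCompletionConjugation.restrictIntegers v w σ) x =
      algebraMap (adicCompletionIntegers K v) (adicCompletionIntegers L w) (u : adicCompletionIntegers K v)) ↔
    IsSquare (residue (adicCompletionIntegers K v) (u : adicCompletionIntegers K v)) := by
  constructor
  · rintro ⟨x, hx⟩
    obtain ⟨a, r, hr, hN⟩ := exists_sq_add_mem_of_normConj v w σ h2 hϖ hπ hram hσ x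
    have : (u : adicCompletionIntegers K v) = a ^ 2 + r :=
      algebraMap_injective v w (hx.symm.trans hN)
    refine ⟨residue (adicCompletionIntegers K v) a, ?_⟩
    rw [this, map_add, map_pow, (residue_eq_zero_iff _).mpr hr, add_zero, sq]
  · exact exists_normConj_eq_of_isSquare_residue v w σ h2u u

end Summit.Ventures.HodgeRepro2.T5TameRamifiedUnitNorms
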